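import Literature.Computability.Complexity.IWBootstrapping
import Literature.Computability.Complexity.ExpPadding
import Literature.Computability.Complexity.NEXPCertificates
import Literature.Computability.Complexity.CodeFPFinite
import Literature.Computability.Complexity.SplitOnesBricks
import Literature.Computability.Complexity.LengthCompare
import HarnessLib

/-!
# Downward self-reducible functions are in `EXP`

Literature / complexity — derandomization under a uniform assumption (Impagliazzo–Wigderson 1998 in
Trevisan–Vadhan's form), the time bound of the hard function. A Boolean function `f` is DOWNWARD
SELF-REDUCIBLE (IW98 Def. 6 with `ℓ(n) = n − 1`, the shape of `IWUniform.mem_BPP_of_dsr_of_stronglyConstructible`,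
`IWBootstrapping.lean`, and of Trevisan–Vadhan's machine `TVChk.dsrAlg_run`, `TVDsrMachine.lean`) when a
polynomial-time oracle algorithm `M` with round budget `bM` outputs `[f x]` on `x` against EVERY oracle
answering `[f y]` on the queries `y` SHORTER than `x`. Trevisan and Vadhan recall that "only problems in
PSPACE can be downward self-reducible" (§1, footnote 2; §3: "all downward self-reducible problems lie in
PSPACE"); the derandomization only uses the consequence that such an `f` is computable in exponential
time (its truth tables feed the generator), and this file proves that consequence directly, by the
dynamic programme over all shorter words:

* **`DsrExp.mem_EXP_of_dsr`** — `{x | f x} ∈ EXP`; language form **`DsrExp.mem_EXP_of_dsr_language`**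
  (first client: Trevisan–Vadhan's `LTV`, `TVLanguageEXP.lean`).

Proof (folklore tabulation, on the tree's toolkit). By upward translation (`mem_EXP_of_expPad`,
`ExpPadding.lean`) it suffices to decide `f x` in polynomial time on the padded input
`1^{2^{|x|}} 0 x`. The decider enumerates the words in order of length through
`NEXPCert.strN i = bin(i+1)` without its leading bit (`NEXPCertificates.lean`), `i < 2 · 2^{|x|}`,
and folds over them a table of pairs `(y, f y)`: the new bit is obtained by running `M` on `y`
with its queries answered from the table built so far (`OracleAlg.simFn`, `OracleSimulateFP.lean`),
which is correct on all shorter words because those precede `y` in the enumeration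
(`DsrExp.idxN_lt_of_length_lt`); finally it looks `x` up. Everything is assembled in the typed
polynomial-time calculus `CodeFP` (`CodeFP*.lean`: folds with polynomially bounded accumulators,
`find?`, maps, ranges), so no machine is programmed here; the table has `2^{|x|+1}` entries of
polynomial size, polynomial in the padded length.

Everything is proved; there are no definitions and no named facts.

## References

* [TrevisanVadhan2007] L. Trevisan, S. Vadhan, *Pseudorandomness and average-case complexity via
  uniform reductions*, Comput. Complexity 16 (2007), §1 (footnote 2) and §3 (before Lemma 3.7):
  downward self-reducible problems lie in `PSPACE` (hence in `EXP`); Lemma 3.6 (the use).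
* [ImpagliazzoWigderson2001] R. Impagliazzo, A. Wigderson, *Randomness vs time: derandomization under
  a uniform assumption*, JCSS 63 (2001), Def. 6 (downward self-reducibility).
* [AroraBarakCC2009] S. Arora, B. Barak, *Computational Complexity: A Modern Approach*, CUP 2009,
  Thm. 2.22 (proof: padding / upward translation), §1.3 (polynomially bounded loops), §3.4 (oracle
  machines run as subroutines).
-/

namespace Literature.Computability.Complexity

open _root_.Computability Polynomial Brick NEXPCert
open CodeFP (strE bitE unE natE pairE rawE unitE optE pairE_apply rawE_cons rawE_nil rawE_append unE_eq_ones
  length_unE)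

namespace DsrExp

/-! ### The enumeration of words by length (`NEXPCert.strN`) -/

/-- `|strN i| = size (i + 1) − 1`. [folklore] -/
theorem length_strN (i : ℕ) : (strN i).length = (i + 1).size - 1 := by
  rw [strN, List.length_dropLast, TM2Pass.length_encodeNat_eq_size]

/-- **Shorter words come first**: a word shorter than `strN i` has index `< i`. [folklore] -/
theorem idxN_lt_of_length_lt {z : List Bool} {i : ℕ} (h : z.length < (strN i).length) : idxN z < i := by
  by_contra hi
  push Not at hi
  have h1 := idxN_lt z
  have h2 : z.length + 1 < (i + 1).size := by rw [length_strN] at h; omega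
  have h3 : 2 ^ (z.length + 1) ≤ i + 1 := Nat.lt_size.1 h2
  omega

/-- Every word of length `≤ n` is `strN i` for some `i < 2^{n+1}`. [folklore] -/
theorem exists_strN_eq {z : List Bool} {n : ℕ} (h : z.length ≤ n) : ∃ i < 2 ^ (n + 1), strN i = z := by
  refine ⟨idxN z, ?_, strN_idxN z⟩
  have h1 := idxN_lt z
  have h2 : 2 ^ (z.length + 1) ≤ 2 ^ (n + 1) := Nat.pow_le_pow_right Nat.two_pos (by omega)
  omega

/-- `strN` on binary numerals is an `FP` string function: add one, drop the last symbol.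
[folklore] -/
theorem strNC : CodeFP natE strE strN := by
  refine CodeFP.of_fn (Plumb.takeFn ∘ fanoutFn List.tail _root_.id ∘ addFn ∘ fanoutFn _root_.id (fun _ => [true]))
    (comp_mem_FP Plumb.takeFn_mem_FP (comp_mem_FP (fanoutFn_mem_FP PRelSigma.tail_mem_FP OracleCompose.id_mem_FP)
      (comp_mem_FP addFn_mem_FP (fanoutFn_mem_FP OracleCompose.id_mem_FP (const_mem_FP _))))) fun i => ?_
  have h2 : bitsToNat [true] = 1 := by simp
  simp only [Function.comp_apply, fanoutFn_apply, id_eq, addFn_boolPair, CodeFP.bitsToNat_natE, h2,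
    Plumb.takeFn_boolPair, List.length_tail, strN, List.dropLast_eq_take]

/-- The list of the first `m` words, from a unary `m`. [folklore] -/
theorem wordsC : CodeFP unE (rawE strE) (fun m => (List.range m).map strN) :=
  (CodeFP.map₀ strNC).comp CodeFP.urange

/-! ### Tables of pairs `(word, bit)` and their lookup -/

/-- **Reading a table**: the bit bound to `q` by the first entry with key `q` (default `false`).
[cite: AroraBarakCC2009, §1.3] -/
theorem lookupC : CodeFP (pairE (rawE (pairE strE bitE)) strE) bitE
    (fun p => ((p.1.find? fun e => e.1 == p.2).map Prod.snd).getD false) := by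
  have hfind := CodeFP.rawFind? (σ := List Bool) (eσ := strE) (eα := pairE strE bitE) (p := fun t => t.2.1 == t.1)
    ((CodeFP.beq (α := List Bool) (eα := strE) Function.injective_id).comp
      ((CodeFP.snd _ _).fst'.pair (CodeFP.fst _ _)))
  have hcase := CodeFP.optCases (σ := Unit) (eσ := unitE) (eα := pairE strE bitE) (eδ := bitE)
    (k := fun _ o => (o.map Prod.snd).getD false) (gnone := fun _ => false) (gsome := fun t => t.2.2)
    (CodeFP.const _ false) ((CodeFP.snd _ _).snd') (fun _ => rfl) (fun _ _ => rfl)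
  exact (hcase.comp ((CodeFP.const _ ()).pair (hfind.comp ((CodeFP.snd _ _).pair (CodeFP.fst _ _))))).congr fun p => rfl

/-- A correct table answers `f` on its keys. [folklore] -/
theorem lookup_eq {f : List Bool → Bool} (T : List (List Bool × Bool)) (hT : ∀ e ∈ T, e.2 = f e.1)
    {q : List Bool} (hq : ∃ e ∈ T, e.1 = q) :
    ((T.find? fun e => e.1 == q).map Prod.snd).getD false = f q := by
  cases h : T.find? (fun e => e.1 == q) with
  | none =>
    obtain ⟨e, he, rfl⟩ := hq
    have := List.find?_eq_none.1 h e he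
    simp at this
  | some e =>
    have h1 : e.1 = q := by simpa using List.find?_some h
    have h2 := List.mem_of_find?_eq_some h
    simp only [Option.map_some, Option.getD_some]
    rw [hT e h2, h1]

/-- **The answering brick of the emulation**: on the tagged query `⟨⟨y, table⟩, q⟩` answer the
table's bit for `q`. [cite: AroraBarakCC2009, §3.4 Example 3.6 (2)] -/
theorem exists_ans : ∃ ans : List Bool → List Bool, ans ∈ FP ∧
    ∀ (y : List Bool) (T : List (List Bool × Bool)) (q : List Bool),
      ans (boolPair (boolPair y (rawE (pairE strE bitE) T)) q) = [((T.find? fun e => e.1 == q).map Prod.snd).getD false] := by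
  obtain ⟨ans, hans, h⟩ := lookupC.comp
    (((CodeFP.fst (pairE strE (rawE (pairE strE bitE))) strE).snd').pair (CodeFP.snd _ _))
  exact ⟨ans, hans, fun y T q => h ((y, T), q)⟩

/-- The code of a table whose keys are `l` is at most `4 ×` the raw code of `l`. [folklore] -/
theorem length_tbl_le (T : List (List Bool × Bool)) (l : List (List Bool)) (h : T.map Prod.fst = l) :
    (rawE (pairE strE bitE) T).length ≤ 4 * (rawE strE l).length := by
  induction T generalizing l with
  | nil => simp
  | cons e T ih =>
    obtain ⟨y, l', rfl⟩ : ∃ y l', l = y :: l' := by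
      cases l with
      | nil => simp at h
      | cons y l' => exact ⟨y, l', rfl⟩
    simp only [List.map_cons, List.cons.injEq] at h
    obtain ⟨rfl, h⟩ := h
    have := ih l' h
    have hb : (bitE e.2).length = 1 := rfl
    simp only [rawE_cons, pairE_apply, length_boolPair]
    omega

/-! ### One step of the dynamic programme, and the fold -/

section Machine

variable {f : List Bool → Bool} {M : OracleAlg (List Bool)} (hM : M.IsPolyTime (encodingList Bool))
  {bM cq : Polynomial ℕ}
  (hcq : ∀ O : Oracle, (∀ q, (O q).length ≤ 1) → ∀ (k : ℕ) (x : List Bool),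
    ∀ q ∈ M.queries O k x, q.length ≤ cq.eval (x.length + k))
  (hDSR : ∀ (x : List Bool) (O : Oracle), (∀ y : List Bool, y.length < x.length → O y = [f y]) →
    M.run O (bM.eval x.length) x = some [f x])
  {ans : List Bool → List Bool} (hans : ans ∈ FP)
  (hspec : ∀ (y : List Bool) (T : List (List Bool × Bool)) (q : List Bool),
    ans (boolPair (boolPair y (rawE (pairE strE bitE) T)) q) = [((T.find? fun e => e.1 == q).map Prod.snd).getD false])

include hcq hDSR hspec in
/-- **The new bit is correct** when the table is correct and holds every shorter word: the emulated
run of `M` on `y` sees `f` on all its shorter queries. [cite: TrevisanVadhan2007, Lemma 3.6 (proof)]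
[cite: AroraBarakCC2009, §3.4 Example 3.6 (2)] -/
theorem simFn_eq {T : List (List Bool × Bool)} {y : List Bool} (hT : ∀ e ∈ T, e.2 = f e.1)
    (hdown : ∀ z : List Bool, z.length < y.length → ∃ e ∈ T, e.1 = z) :
    OracleAlg.simFn M fstF ans (cq.comp (X + bM)) bM (boolPair y (rawE (pairE strE bitE) T)) = [f y] := by
  set w := boolPair y (rawE (pairE strE bitE) T) with hw
  have hO1 : ∀ q, (ans (boolPair w q)).length ≤ 1 := fun q => by rw [hw, hspec]; simp
  have hshort : ∀ q : List Bool, q.length < y.length → ans (boolPair w q) = [f q] := fun q hq => by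
    rw [hw, hspec, lookup_eq T hT (hdown q hq)]
  have hrun0 := hDSR y (fun q => ans (boolPair w q)) hshort
  have hyw : y.length ≤ w.length := by rw [hw, length_boolPair]; omega
  have hfst : fstF w = y := by rw [hw, fstF_boolPair]
  have hrun : M.run (fun q => ans (boolPair w q)) (bM.eval w.length) (fstF w) = some [f y] := by
    rw [hfst]
    exact M.run_mono _ _ (TM2Iter.eval_mono bM hyw) hrun0
  refine OracleAlg.simFn_eq_of_run hrun fun q hq => ?_
  have h1 := hcq _ hO1 (bM.eval w.length) (fstF w) q hq
  rw [hfst] at h1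
  calc q.length ≤ cq.eval (y.length + bM.eval w.length) := h1
    _ ≤ cq.eval (w.length + bM.eval w.length) := TM2Iter.eval_mono cq (by omega)
    _ = (cq.comp (X + bM)).eval w.length := by simp [eval_comp]

include hcq hDSR hspec in
/-- The same, as the decided bit. [folklore] -/
theorem bit_eq {T : List (List Bool × Bool)} {y : List Bool} (hT : ∀ e ∈ T, e.2 = f e.1)
    (hdown : ∀ z : List Bool, z.length < y.length → ∃ e ∈ T, e.1 = z) :
    decide (OracleAlg.simFn M fstF ans (cq.comp (X + bM)) bM (boolPair y (rawE (pairE strE bitE) T)) = [true]) = f y := by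
  rw [simFn_eq hcq hDSR hspec hT hdown]
  cases f y <;> decide

include hM hans in
/-- **The step of the fold on codes**: `(y, T) ↦ T ++ [(y, new bit)]`.
[cite: AroraBarakCC2009, §1.3 and §3.4] -/
theorem stepC (c R : Polynomial ℕ) : CodeFP (pairE strE (rawE (pairE strE bitE))) (rawE (pairE strE bitE))
    (fun t => t.2 ++ [(t.1, decide (OracleAlg.simFn M fstF ans c R (boolPair t.1 (rawE (pairE strE bitE) t.2)) = [true]))]) := by
  have hsim : CodeFP (pairE strE (rawE (pairE strE bitE))) strE
      (fun t => OracleAlg.simFn M fstF ans c R (boolPair t.1 (rawE (pairE strE bitE) t.2))) :=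
    CodeFP.of_fn _ (OracleAlg.simFn_mem_FP hM fstF_mem_FP hans c R) fun _ => rfl
  have hbit : CodeFP (pairE strE (rawE (pairE strE bitE))) bitE
      (fun t => decide (OracleAlg.simFn M fstF ans c R (boolPair t.1 (rawE (pairE strE bitE) t.2)) = [true])) :=
    (CodeFP.eq (α := List Bool) (eα := strE) Function.injective_id).comp (hsim.pair (CodeFP.const _ [true]))
  exact (CodeFP.rawAppend (pairE strE bitE)).comp ((CodeFP.snd _ _).pair
    ((CodeFP.rawSingleton (pairE strE bitE)).comp ((CodeFP.fst _ _).pair hbit)))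

/-- The keys of the folded table are the folded words. [folklore] -/
theorem map_fst_foldl (bit : List Bool → List (List Bool × Bool) → Bool) (l : List (List Bool))
    (T₀ : List (List Bool × Bool)) :
    (l.foldl (fun T y => T ++ [(y, bit y T)]) T₀).map Prod.fst = T₀.map Prod.fst ++ l := by
  induction l generalizing T₀ with
  | nil => simp
  | cons y l ih => rw [List.foldl_cons, ih]; simp

include hM hans in
/-- **The table fold on codes** (its accumulator is linearly bounded: `length_tbl_le`).
[cite: AroraBarakCC2009, §1.3 (polynomially bounded loops)] -/
theorem tblC (c R : Polynomial ℕ) : CodeFP (rawE strE) (rawE (pairE strE bitE))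
    (fun l => l.foldl (fun T y => T ++ [(y, decide (OracleAlg.simFn M fstF ans c R
      (boolPair y (rawE (pairE strE bitE) T)) = [true]))]) []) := by
  refine CodeFP.foldl₀ (eα := strE) (eβ := rawE (pairE strE bitE))
    (step := fun y T => T ++ [(y, decide (OracleAlg.simFn M fstF ans c R (boolPair y (rawE (pairE strE bitE) T)) = [true]))])
    (b₀ := []) (stepC hM hans c R) (4 * X) fun l₁ l₂ => ?_
  rw [eval_mul, eval_X]
  simp only [eval_ofNat]
  refine (length_tbl_le _ l₁ ?_).trans ?_
  · have := map_fst_foldl (fun y T => decide (OracleAlg.simFn M fstF ans c R (boolPair y (rawE (pairE strE bitE) T)) = [true])) l₁ []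
    simpa using this
  · rw [rawE_append, List.length_append]
    omega

include hcq hDSR hspec in
/-- **Invariant of the dynamic programme**: every entry of the table folded over the first `n`
words is correct. [cite: TrevisanVadhan2007, Lemma 3.6 (proof: "f on shorter inputs first")] -/
theorem foldl_correct (n : ℕ) :
    ∀ e ∈ ((List.range n).map strN).foldl (fun T y => T ++ [(y, decide (OracleAlg.simFn M fstF ans (cq.comp (X + bM)) bM
      (boolPair y (rawE (pairE strE bitE) T)) = [true]))]) [], e.2 = f e.1 := by
  induction n with
  | zero => simp
  | succ n ih =>
    intro e he
    rw [List.range_succ, List.map_append, List.map_singleton, List.foldl_append, List.foldl_cons, List.foldl_nil,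
      List.mem_append, List.mem_singleton] at he
    rcases he with he | rfl
    · exact ih e he
    · refine bit_eq hcq hDSR hspec ih fun z hz => ?_
      have hidx := idxN_lt_of_length_lt hz
      have hkeys := map_fst_foldl (fun y T => decide (OracleAlg.simFn M fstF ans (cq.comp (X + bM)) bM
        (boolPair y (rawE (pairE strE bitE) T)) = [true])) ((List.range n).map strN) []
      simp only [List.map_nil, List.nil_append] at hkeys
      have hz' : z ∈ (List.map Prod.fst (((List.range n).map strN).foldl (fun T y => T ++ [(y, decide (OracleAlg.simFn M fstF ans
          (cq.comp (X + bM)) bM (boolPair y (rawE (pairE strE bitE) T)) = [true]))]) [])) := by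
        rw [hkeys]
        exact List.mem_map.2 ⟨idxN z, List.mem_range.2 hidx, strN_idxN z⟩
      obtain ⟨e, he, hez⟩ := List.mem_map.1 hz'
      exact ⟨e, he, hez⟩

include hM hans in
/-- **The whole decider on the typed padded input** `(P, x)`: fold the table over the first `2P`
words and look `x` up. [cite: AroraBarakCC2009, §1.3] -/
theorem decideC : CodeFP (pairE unE strE) bitE (fun p : ℕ × List Bool =>
    (((((List.range (p.1 + p.1)).map strN).foldl (fun T y => T ++ [(y, decide (OracleAlg.simFn M fstF ans (cq.comp (X + bM)) bM
      (boolPair y (rawE (pairE strE bitE) T)) = [true]))]) []).find? fun e => e.1 == p.2).map Prod.snd).getD false) :=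
  lookupC.comp ((((tblC hM hans (cq.comp (X + bM)) bM).comp (wordsC.comp (CodeFP.unAdd.comp
    ((CodeFP.fst _ _).pair (CodeFP.fst _ _))))).pair (CodeFP.snd _ _)))

include hcq hDSR hspec in
/-- **Its value at `P = 2^{|x|}` is `f x`.** [cite: TrevisanVadhan2007, Lemma 3.6 (proof)] -/
theorem decide_eq (x : List Bool) :
    (((((List.range (2 ^ x.length + 2 ^ x.length)).map strN).foldl (fun T y => T ++ [(y, decide (OracleAlg.simFn M fstF ans
      (cq.comp (X + bM)) bM (boolPair y (rawE (pairE strE bitE) T)) = [true]))]) []).find? fun e => e.1 == x).map Prod.snd).getD false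
      = f x := by
  refine lookup_eq _ (foldl_correct hcq hDSR hspec _) ?_
  have hkeys := map_fst_foldl (fun y T => decide (OracleAlg.simFn M fstF ans (cq.comp (X + bM)) bM
    (boolPair y (rawE (pairE strE bitE) T)) = [true])) ((List.range (2 ^ x.length + 2 ^ x.length)).map strN) []
  simp only [List.map_nil, List.nil_append] at hkeys
  obtain ⟨i, hi, hix⟩ := exists_strN_eq (le_refl x.length)
  have hx : x ∈ (List.map Prod.fst (((List.range (2 ^ x.length + 2 ^ x.length)).map strN).foldl (fun T y => T ++ [(y,
      decide (OracleAlg.simFn M fstF ans (cq.comp (X + bM)) bM (boolPair y (rawE (pairE strE bitE) T)) = [true]))]) [])) := by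
    rw [hkeys]
    exact List.mem_map.2 ⟨i, List.mem_range.2 (by rw [pow_succ] at hi; omega), hix⟩
  obtain ⟨e, he, hex⟩ := List.mem_map.1 hx
  exact ⟨e, he, hex⟩

end Machine

/-! ### The theorem -/

/-- **Downward self-reducible functions are in `EXP`.** If a polynomial-time oracle algorithm `M`
with round budget `bM` outputs `[f x]` on every `x` against every oracle answering `[f y]` on the
queries `y` shorter than `x` (IW98 Def. 6 with `ℓ(n) = n − 1`), then `{x | f x} ∈ EXP`
(Trevisan–Vadhan: "all downward self-reducible problems lie in PSPACE" ⊆ `EXP`; proved here by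
tabulating `f` on all shorter words in order of length, `2^{O(n)} · poly(n)` time, through the
padded language `{1^{2^{|x|}} 0 x}` in `P`). [cite: TrevisanVadhan2007, §3 (before Lemma 3.7) and §1 footnote 2]
[cite: ImpagliazzoWigderson2001, Def. 6] [cite: AroraBarakCC2009, Thm. 2.22 (proof: padding)] -/
theorem mem_EXP_of_dsr {f : List Bool → Bool} {M : OracleAlg (List Bool)} (hM : M.IsPolyTime (encodingList Bool))
    {bM : Polynomial ℕ}
    (hDSR : ∀ (x : List Bool) (O : Oracle), (∀ y : List Bool, y.length < x.length → O y = [f y]) →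
      M.run O (bM.eval x.length) x = some [f x]) :
    {x | f x = true} ∈ EXP := by
  classical
  obtain ⟨cq, hcq⟩ := hM.exists_queryBound
  have hcq' : ∀ O : Oracle, (∀ q, (O q).length ≤ 1) → ∀ (k : ℕ) (x : List Bool),
      ∀ q ∈ M.queries O k x, q.length ≤ cq.eval (x.length + k) := fun O hO k x => (hcq O hO k x).1
  obtain ⟨ans, hans, hspec⟩ := exists_ans
  obtain ⟨F, hF, hFg⟩ := decideC hM (bM := bM) (cq := cq) hans
  -- the decider of the padded language
  let G : List Bool → List Bool := F ∘ fanoutFn onesPrefixFn afterZeroFn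
  have hG : G ∈ FP := comp_mem_FP hF (fanoutFn_mem_FP onesPrefixFn_mem_FP afterZeroFn_mem_FP)
  have hGw : ∀ w, G w = F (pairE unE strE ((splitOnes w).1, afterZeroFn w)) := fun w => by
    show F (fanoutFn onesPrefixFn afterZeroFn w) = _
    rw [fanoutFn_apply, pairE_apply, unE_eq_ones]
    rfl
  have hGbit : ∀ w, ∃ b : Bool, G w = [b] := fun w => by
    rw [hGw]
    exact ⟨_, hFg _⟩
  have hGpad : ∀ x, G (expPad 1 x) = [f x] := fun x => by
    have hpad : expPad 1 x = ones (2 ^ x.length) ++ false :: x := by simp [expPad, ones]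
    have h1 : (splitOnes (expPad 1 x)).1 = 2 ^ x.length := by rw [hpad, splitOnes_ones_append]
    have h2 : afterZeroFn (expPad 1 x) = x := by rw [hpad, afterZeroFn_ones_append]
    rw [hGw, h1, h2, hFg]
    dsimp only
    rw [decide_eq hcq' hDSR hspec x]
    rfl
  let L' : Language Bool := {w | G w = [true]}
  have hL' : L' ∈ Classes.P := by
    refine mem_P_of_mem_FP hG L' fun w => ⟨fun h => h, fun h => ?_⟩
    obtain ⟨b, hb⟩ := hGbit w
    cases b
    · exact hb
    · exact absurd hb h
  refine mem_EXP_of_expPad (k := 1) le_rfl (L' := L') (fun x => ?_) hL'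
  show f x = true ↔ G (expPad 1 x) = [true]
  rw [hGpad]
  simp

/-- **Language form**: a language with a polynomial-time downward self-reduction (an oracle
algorithm deciding `x ∈ S` against every oracle presenting `S` on the words shorter than `x`, the
shape of `TVChk.dsrAlg_run`) is in `EXP`. [cite: TrevisanVadhan2007, §3 (before Lemma 3.7)]
[cite: ImpagliazzoWigderson2001, Def. 6] -/
theorem mem_EXP_of_dsr_language {S : Language Bool} {M : OracleAlg (List Bool)} (hM : M.IsPolyTime (encodingList Bool))
    {bM : Polynomial ℕ}
    (hDSR : ∀ (x : List Bool) (O : Oracle), (∀ y : List Bool, y.length < x.length → O y = Oracle.ofLanguage S y) →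
      M.run O (bM.eval x.length) x = some (Oracle.ofLanguage S x)) :
    S ∈ EXP := by
  have h := mem_EXP_of_dsr (f := S.boolIndicator) hM (bM := bM) (fun x O hO => hDSR x O fun y hy => hO y hy)
  have hS : S = {x | S.boolIndicator x = true} := Set.ext fun x => Set.mem_iff_boolIndicator _ _
  rw [hS]
  exact h

end DsrExp

end Literature.Computability.Complexity
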